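import Literature.NumberTheory.Sieve.PolymathGEH
import Literature.NumberTheory.Sieve.PolymathGEHCutoff
import Literature.NumberTheory.Sieve.PolymathGEHTensorCutoffs
import Literature.NumberTheory.Sieve.PolymathGEHToEH
import Literature.NumberTheory.Sieve.PolymathGEHNonprime
import HarnessLib

/-!
# Polymath 8b, Theorem 3.2(xii) from Theorem 3.14 and Theorem 3.15

Trunk AntSieve, "Proofs" companion of `PolymathGEH.lean` (the named fact
`Literature.NumberTheory.Sieve.weakDHL_three_two_of_GEH`: D. H. J. Polymath, *Variants of the
Selberg sieve, and bounded intervals containing many primes*, Res. Math. Sci. 1:12 (2014) =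
arXiv:1407.4897, Theorem 3.2(xii), `GEH ⟹ DHL[3,2]`).

p. 11: "Theorem 3.2(xii) is then an immediate consequence of Theorem 3.14 and the following numerical
fact [Theorem 3.15]."  Theorem 3.15 is PROVED in the tree
(`GEHCutoff.exists_vanishingMarginalCutoff_three`, `PolymathGEHCutoff.lean`).  Theorem 3.14
("going beyond the epsilon enlargement": under `GEH[ϑ]`, `0 < ε < 1/(k-1)`, a square-integrable
`F` on `(k/(k-1))·R_k` with vanishing marginals beyond `1 + ε` and `Σᵢ J_{i,1-ε}(F)/I(F) > 2m/ϑ`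
gives `DHL[k, m+1]`; proof in §5.4 from the GEH sieve asymptotic Theorem 3.6(ii) and
Theorem 3.5(i)) is NOT yet in the tree; under D-0026 it is not vendored as a named fact here.

This file records the printed deduction as a theorem CONDITIONAL on Theorem 3.14, stated in full
generality as an explicit hypothesis (`weakDHL_three_two_of_GEH_of_theorem314`): with `k = 3`,
`m = 1`, `ε = 1/4 < 1/2`, the cutoff of Theorem 3.15 and any `ϑ ∈ (2I(F)/Σᵢ Jᵢ(F), 1)` (possible as
the ratio exceeds `2`), `GEH[ϑ]` being available for every `ϑ < 1` by hypothesis.  What remains for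
the unconditional `weakDHL_three_two_of_GEH_holds` is exactly a proof of Theorem 3.14 (rendered as in
the hypothesis below: `k = n + 1`, marginal condition almost everywhere — the form the printed proof
uses and Theorem 3.15 provides).

## The discharge

`weakDHL_three_two_of_GEH_holds` (at the end of this file) now PROVES the named fact, along the
printed route: Theorem 3.2(xii) from the level of distribution of the primes and the `GEH` non-prime
asymptotic Theorem 3.6(ii) (`weakDHL_three_two_of_primesLevel_of_nonprimeAsymptotic`,
`PolymathGEHTensorCutoffs.lean`, which formalises Theorem 3.14 (§5.4, with the cutoffs of Theorem
3.15, §7) for `k = 3`, `m = 1`); the level of the primes `EH[θ]` for every `θ < 1` from `GEH` by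
Proposition 2.7 (`GEHtoEH.primesHaveLevel_of_forall_geh`, `PolymathGEHToEH.lean`); and Theorem
3.6(ii) from `GEH` (`Nonprime.nonprime_asymptotic_of_GEH`, `PolymathGEHNonprime.lean`: §4.5 with
Proposition 4.2).  The conditional statement `weakDHL_three_two_of_GEH_of_theorem314` is kept.

## References

* [Polymath8b2014] D. H. J. Polymath, Res. Math. Sci. 1 (2014), Art. 12 = arXiv:1407.4897,
  Theorem 3.2(xii) (p. 8), Theorems 3.14–3.15 (p. 11), §5.4; Theorem 3.6(ii) and §4.5; Prop. 2.7.
-/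

noncomputable section

open MeasureTheory Finset

namespace Literature.NumberTheory.Sieve

/-- **Theorem 3.2(xii) from Theorem 3.14** (p. 11: "an immediate consequence of Theorem 3.14 and
[Theorem 3.15]"), with Theorem 3.15 supplied by the tree
(`GEHCutoff.exists_vanishingMarginalCutoff_three`) and Theorem 3.14 as an explicit hypothesis in its
printed generality (`k = n + 1 ≥ 2`, `m ≥ 1`, `GEH[ϑ]` for one `0 < ϑ < 1`, `0 < ε < 1/(k-1)`, `F`
bounded measurable supported on `(k/(k-1))·R_k` with vanishing marginals (a.e.) beyond `1 + ε`,
`I(F) > 0` and `Σᵢ J_{i,1-ε}(F) > (2m/ϑ) I(F)` give `DHL[k, m+1]`).  Deduction: `k = 3`, `m = 1`,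
`ε = 1/4`, and `ϑ := (1 + ρ)/2` where `ρ = 2I(F)/Σᵢ Jᵢ(F) < 1`. [cite: Polymath8b2014, Theorem 3.2(xii) (deduction from Theorems 3.14 and 3.15, p. 11)] -/
theorem weakDHL_three_two_of_GEH_of_theorem314
    (h314 : ∀ (n m : ℕ), 1 ≤ n → 1 ≤ m → ∀ (ϑ : ℝ), 0 < ϑ → ϑ < 1 → GeneralizedElliottHalberstam ϑ →
      ∀ (ε : ℝ), 0 < ε → ε < 1 / n →
      ∀ (F : (Fin (n + 1) → ℝ) → ℝ), Measurable F → (∃ C : ℝ, ∀ t, |F t| ≤ C) →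
        Function.support F ⊆ scaledSimplex (n + 1) ((n + 1 : ℝ) / n) →
        (∀ i : Fin (n + 1), ∀ᵐ t' : Fin n → ℝ, (∀ j, 0 ≤ t' j) → 1 + ε < ∑ j, t' j →
          ∫ u in Set.Ioi 0, F (Fin.insertNth i u t') = 0) →
        0 < polymathI (n + 1) F →
        2 * (m : ℝ) / ϑ * polymathI (n + 1) F < ∑ i, polymathJ (n + 1) (1 - ε) i F →
        WeakDicksonHardyLittlewood (n + 1) (m + 1)) :
    weakDHL_three_two_of_GEH := by
  intro hGEH
  obtain ⟨F, hFm, hFb, hFs, -, hmarg, hIpos, hratio⟩ := GEHCutoff.exists_vanishingMarginalCutoff_three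
  -- the ratio `ρ = 2 I / Σ J < 1`, and `ϑ := (1 + ρ)/2`
  set S : ℝ := ∑ i : Fin 3, polymathJ 3 (1 - 1 / 4) i F with hS
  have hSpos : 0 < S := lt_trans (by positivity) hratio
  set ρ : ℝ := 2 * polymathI 3 F / S with hρ
  have hρ1 : ρ < 1 := by rw [hρ, div_lt_one hSpos]; exact hratio
  have hρ0 : 0 < ρ := by rw [hρ]; positivity
  set ϑ : ℝ := (1 + ρ) / 2 with hϑ
  have hϑ0 : 0 < ϑ := by rw [hϑ]; linarith
  have hϑ1 : ϑ < 1 := by rw [hϑ]; linarith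
  have hϑρ : ρ < ϑ := by rw [hϑ]; linarith
  have key : 2 * ((1 : ℕ) : ℝ) / ϑ * polymathI 3 F < S := by
    rw [Nat.cast_one, mul_one]
    have h1 : 2 * polymathI 3 F = ρ * S := by rw [hρ]; field_simp
    rw [div_mul_eq_mul_div, h1, div_lt_iff₀ hϑ0]
    nlinarith
  have h := h314 2 1 (by norm_num) le_rfl ϑ hϑ0 hϑ1 (hGEH ϑ hϑ0 hϑ1) (1 / 4) (by norm_num) (by norm_num) F hFm hFb
    (by
      have e : ((2 : ℕ) + 1 : ℝ) / (2 : ℕ) = 3 / 2 := by norm_num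
      rw [e]
      exact hFs)
    hmarg hIpos key
  simpa using h

/-- **Discharge of `weakDHL_three_two_of_GEH` (Polymath 8b, Theorem 3.2(xii): `GEH ⟹ DHL[3,2]`).**
p. 11: "Theorem 3.2(xii) is then an immediate consequence of Theorem 3.14 and [Theorem 3.15]"; here
assembled as: the reduction of Theorem 3.2(xii) to the level of distribution of the primes and the
`GEH` non-prime asymptotic Theorem 3.6(ii) (`weakDHL_three_two_of_primesLevel_of_nonprimeAsymptotic`,
which contains Theorems 3.14 (§5.4) and 3.15 (§7)), the level of the primes from `GEH` via
Proposition 2.7 (`GEHtoEH.primesHaveLevel_of_forall_geh`), and Theorem 3.6(ii) proved in §4.5 from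
`GEH` (`Nonprime.nonprime_asymptotic_of_GEH`: truncation at the small primes, Proposition 4.2, the
level of distribution of the truncated divisor sums from `GEH`, the main term (cpeps) and the
depolarisation limit `ε → 0`). [cite: Polymath8b2014, Theorem 3.2(xii) (via Theorems 3.14–3.15, 3.6(ii), Prop. 2.7)] -/
theorem weakDHL_three_two_of_GEH_holds : weakDHL_three_two_of_GEH := fun hGEH =>
  weakDHL_three_two_of_primesLevel_of_nonprimeAsymptotic
    (fun _ _ hθ1 => GEHtoEH.primesHaveLevel_of_forall_geh hGEH hθ1)
    (fun _ hθ0 hθ1 H hH hk b hb h₀ hh₀ F G sF sG hF hG hsum =>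
      Nonprime.nonprime_asymptotic_of_GEH hGEH hθ0 hθ1 H hH hk b hb h₀ hh₀ F G sF sG hF hG hsum)

end Literature.NumberTheory.Sieve
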